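import Summits.ResolutionOfSingularities.ResolutionOfSingularities.Theorems.PurelyInseparableDim4JointChain
import HarnessLib

/-!
# Purely inseparable four-folds: the JOINT CHAIN from the ROOT — first a coordinate blow-up of `z^p + F` along a
# permissible `V(z, x_S)`, then the point regime (brick S3 (c) «joint point∘coordinate chains», part 3, cell `res-dim4-pi`)

[OURS · counted 0] (D-0157 DOOR 2; desk WORD #66 (4)(c); frame `PIDim4.TerminationImpliesOrderReduction`, S3 (c);
host item stmt-ResolutionOfSingularities-16155, helper). Nothing here proves resolution of singularities in
dimension ≥ 4 / characteristic `p` — NOT here, not anywhere in this programme.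

The root instance of part 2's `exists_isMarkedResolution_coord_step_then_points` (`X = X′ = 𝔸⁵_K`, `σ = 𝟙`, `φ = 𝟙`):
all hypotheses are statements about the polynomial `F` and the tree's combinatorial walks.

* §1 **`finite_closedPoints_off_of_finite_roots`** —
  finitely many root parameters `b` OFF the centre (`¬ b|_S = 0`) ⇒ finitely many closed order-`p` points of
  `(z^p + F)·𝒪` off `V(z, x_S)`; `globalCentre_id` (typ-2's global centre of the identity chart IS `𝓘Λ`).
* §2 **`exists_isMarkedResolution_coord_root_then_walk`** — `K = K̄` of characteristic `p`, `F ≠ 0` clean,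
  `V(z, x_S)` Hironaka-permissible for `z^p + F`, `π : W → 𝔸⁵_K` ANY blowing up along it. Suppose: (over the centre)
  finitely many equimultiple pairs `(j, b)` (`j ∈ S`, `b_j = 0`, `IsEquimultiplePoint p S j b (F, 0, ∅)`), and below
  each successor state `step p S j b (F, 0, ∅)` the POINT walk is well-founded (`Acc`) and finitely branching; (off
  the centre) finitely many root parameters `b` with `¬ b|_S = 0`, and below each re-centred root state
  `(deletePthPowers p (F(x + b)), 0, ∅)` the point walk is well-founded and finitely branching. Then
  `(𝔸⁵_K, (z^p + F)·𝒪, [], p)` admits a marked resolution (BGMW Def. 3.1.3) whose FIRST blow-up is `π` — the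
  conclusion of `PIDim4.OrderReduction p` for `F`, reached by a MIXED chain (one coordinate centre of positive
  dimension, then closed points).

HONEST SCOPE: one coordinate move; afterwards isolated order-`p` points only (finite branching); nothing about
termination. AI-produced formalisation, weaker than expert review. bears_on: LADDER-RESOLUTION:D157-DOOR2
(res-dim4-pi · S3 (c) joint).
-/

set_option linter.dupNamespace false -- D-0017: single-problem summit path `Summit.<S>.<S>.…` by design

noncomputable section

open MvPolynomial Finset CategoryTheory AlgebraicGeometry Opposite TopologicalSpace
open AlgebraicGeometry.Scheme.IdealSheafData (ofIdealTop vanishingIdeal)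

namespace Summit.ResolutionOfSingularities.ResolutionOfSingularities.Theorems.PIDim4

open Literature.AlgebraicGeometry.Resolution
open Literature.AlgebraicGeometry.Resolution.Hauser2010
open Literature.AlgebraicGeometry.Resolution.AffinePointBlowup (P A γ coord Wtop ξ)

namespace Equimultiple

/-! ## §1 Closed order-`p` points off the centre; the global centre of the identity chart -/

section OffCentre

variable {K : Type} [Field K] {p : ℕ} [hp : Fact p.Prime] [CharP K p]

/-- **Finitely many root parameters off the centre ⇒ finitely many closed order-`p` points off the centre**
(`K = K̄`, `p ≤ ord_{(x_S)} F`): a closed point of order `≥ p` of `(z^p + F)·𝒪` is `((-F(b))^{1/p}, b)` with every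
non-constant monomial of degree `< p` of `F(x + b)` vanishing; if `b|_S = 0` then `F(b) = 0`, the point is `(0, b)` and
lies ON `V(z, x_S)`. [cite: Hauser2010, §F (equiconstant points)] -/
theorem finite_closedPoints_off_of_finite_roots [IsAlgClosed K] (F : MvPolynomial (Fin 4) K) {S : Finset (Fin 4)}
    (hperm : (p : ℕ∞) ≤ CentreBlowup.ordAlong S F)
    (hfin : {b : Fin 4 → K | (∀ d : Fin 4 →₀ ℕ, d ≠ 0 → d.degree < p →
      coeff d (PointBlowup.translate b F) = 0) ∧ ¬ ∀ i ∈ S, b i = 0}.Finite) :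
    {x : P 4 K | IsClosed ({x} : Set (P 4 K)) ∧ (p : ℕ∞) ≤ idealOrder (hypSheaf p F) x ∧
      x ∉ AffineCoordBlowup.CΛ 4 K (insert 0 (Fin.succ '' (S : Set (Fin 4))))}.Finite := by
  haveI : PerfectRing K p := PerfectRing.ofSurjective K p fun x => IsAlgClosed.exists_pow_nat_eq x hp.out.pos
  let pt : (Fin (4 + 1) → K) → P 4 K := fun v => ⟨MvPolynomial.vanishingIdeal K {v}, inferInstance⟩
  let g : (Fin 4 → K) → P 4 K := fun b => pt (Fin.cons ((frobeniusEquiv K p).symm (-MvPolynomial.eval b F)) b)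
  refine (hfin.image g).subset fun x hx => ?_
  obtain ⟨hxc, hord, hxC⟩ := hx
  obtain ⟨a, b, hxab⟩ := exists_eq_vanishingIdeal_cons_of_isClosed hxc
  have hord' := (natCast_le_idealOrder_hypSheaf_iff (p := p) F hxab p).mp hord
  rw [natCast_le_ordZero_translate_hyp_iff] at hord'
  obtain ⟨hab, H⟩ := hord'
  have ha : (frobeniusEquiv K p).symm (-MvPolynomial.eval b F) = a := by
    apply (frobeniusEquiv K p).injective
    rw [RingEquiv.apply_symm_apply, frobeniusEquiv_def]
    exact (eq_neg_of_add_eq_zero_left hab).symm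
  refine ⟨b, ⟨H, fun hbS => hxC ?_⟩, ?_⟩
  · -- `b|_S = 0 ⇒ F(b) = 0 ⇒ a = 0 ⇒ x ∈ V(z, x_S)`
    have hFb : MvPolynomial.eval b F = 0 :=
      eval_eq_zero_of_one_le_ordAlong (le_trans (by exact_mod_cast hp.out.one_lt.le) hperm) hbS
    have ha0 : a = 0 := by
      rw [hFb, add_zero] at hab
      exact pow_eq_zero_iff hp.out.ne_zero |>.mp hab
    exact mem_CΛ_of_cons hxab ha0 hbS
  · apply PrimeSpectrum.ext
    change MvPolynomial.vanishingIdeal K {(Fin.cons ((frobeniusEquiv K p).symm (-MvPolynomial.eval b F)) b :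
      Fin (4 + 1) → K)} = x.asIdeal
    rw [ha, hxab]

omit hp [CharP K p] in
/-- **The global centre of the identity chart is the coordinate centre itself**: `𝓘(closure 𝟙(V(x_Λ))) = 𝓘Λ`
(`𝓘Λ` is by definition the vanishing ideal of the closed set `V(x_Λ)`). [folklore] -/
theorem globalCentre_id (Λ : Set (Fin (4 + 1))) :
    vanishingIdeal (closureImage (𝟙 (P 4 K)) ((AffineCoordBlowup.𝓘Λ 4 K Λ).support : Set (P 4 K))) =
      AffineCoordBlowup.𝓘Λ 4 K Λ := by
  have hid : ((𝟙 (P 4 K) : P 4 K ⟶ P 4 K) : P 4 K → P 4 K) = id := funext fun _ => rfl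
  have h : closureImage (𝟙 (P 4 K)) ((AffineCoordBlowup.𝓘Λ 4 K Λ).support : Set (P 4 K)) =
      AffineCoordBlowup.CΛ 4 K Λ := by
    apply Closeds.ext
    rw [coe_closureImage, AffineCoordBlowup.support_𝓘Λ, hid, Set.image_id, (AffineCoordBlowup.CΛ 4 K Λ).isClosed.closure_eq]
  rw [h]
  rfl

omit hp [CharP K p] in
/-- The image of a set under the identity chart. [folklore] -/
theorem image_id_eq (T : Set (P 4 K)) : ((𝟙 (P 4 K) : P 4 K ⟶ P 4 K) : P 4 K → P 4 K) '' T = T := by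
  have hid : ((𝟙 (P 4 K) : P 4 K ⟶ P 4 K) : P 4 K → P 4 K) = id := funext fun _ => rfl
  rw [hid, Set.image_id]

end OffCentre

/-! ## §2 The joint chain from the root -/

section Root

variable {K : Type} [Field K] {p : ℕ} [hp : Fact p.Prime] [CharP K p]

/-- **THE JOINT CHAIN FROM THE ROOT (coordinate move first, then points).** See the module docstring.
[cite: BierstoneGrigorievMilmanWlodarczyk2011, Def. 3.1.3] [cite: Hauser2010, §§F–G]
[cite: HauserPerlega2019PRIMS, §2 (permissible centres P = (z, x_i : i ∈ Γ))]
[cite: Hironaka1964, Main Theorem I (the characteristic-zero statement whose analogue is asked)] -/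
theorem exists_isMarkedResolution_coord_root_then_walk [IsAlgClosed K] [DecidableEq K] (F : MvPolynomial (Fin 4) K)
    (hF : F ≠ 0) (hclean : Literature.Barriers.ResolutionOfSingularities.HauserPerlega.IsClean p F)
    {S : Finset (Fin 4)} (hS : IsPermissibleCentre p S F) {W : Scheme.{0}} {π : W ⟶ P 4 K}
    (hπ : IsBlowup π (AffineCoordBlowup.𝓘Λ 4 K (insert 0 (Fin.succ '' (S : Set (Fin 4))))))
    (hfin : {jb : Fin 4 × (Fin 4 → K) | jb.1 ∈ S ∧ jb.2 jb.1 = 0 ∧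
      CentreBlowup.IsEquimultiplePoint p S jb.1 jb.2 (⟨F, 0, ∅⟩ : State K)}.Finite)
    (hwalk : ∀ (j : Fin 4) (b : Fin 4 → K), j ∈ S → b j = 0 →
      CentreBlowup.IsEquimultiplePoint p S j b (⟨F, 0, ∅⟩ : State K) →
      Acc (fun s' s : State K => Edge p Finset.univ s s') (CentreBlowup.step p S j b (⟨F, 0, ∅⟩ : State K)) ∧
        ∀ s' : State K, Relation.ReflTransGen (fun a c : State K => Edge p Finset.univ a c)
            (CentreBlowup.step p S j b (⟨F, 0, ∅⟩ : State K)) s' →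
          {jb : Fin 4 × (Fin 4 → K) | jb.2 jb.1 = 0 ∧
            CentreBlowup.IsEquimultiplePoint p Finset.univ jb.1 jb.2 s'}.Finite)
    (hroots : {b : Fin 4 → K | (∀ d : Fin 4 →₀ ℕ, d ≠ 0 → d.degree < p →
      coeff d (PointBlowup.translate b F) = 0) ∧ ¬ ∀ i ∈ S, b i = 0}.Finite)
    (hwalk₀ : ∀ b : Fin 4 → K, (∀ d : Fin 4 →₀ ℕ, d ≠ 0 → d.degree < p → coeff d (PointBlowup.translate b F) = 0) →
      (¬ ∀ i ∈ S, b i = 0) →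
      Acc (fun s' s : State K => Edge p Finset.univ s s')
          (⟨deletePthPowers p (PointBlowup.translate b F), 0, ∅⟩ : State K) ∧
        ∀ s' : State K, Relation.ReflTransGen (fun a c : State K => Edge p Finset.univ a c)
            (⟨deletePthPowers p (PointBlowup.translate b F), 0, ∅⟩ : State K) s' →
          {jb : Fin 4 × (Fin 4 → K) | jb.2 jb.1 = 0 ∧
            CentreBlowup.IsEquimultiplePoint p Finset.univ jb.1 jb.2 s'}.Finite) :
    ∃ (X' : Scheme.{0}) (ρ : X' ⟶ P 4 K) (M' : MarkedIdeal X'),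
      IsMarkedResolution (⟨hypSheaf p F, [], p⟩ : MarkedIdeal (P 4 K)) ρ M' := by
  classical
  haveI : PerfectRing K p := PerfectRing.ofSurjective K p fun x => IsAlgClosed.exists_pow_nat_eq x hp.out.pos
  set M₀ : MarkedIdeal (P 4 K) := ⟨hypSheaf p F, [], p⟩ with hM₀
  have hE₀ : HasSNC M₀.boundary :=
    hasSNC_nil_of_isRegular (Literature.AlgebraicGeometry.Hironaka2017.Lib.AffinePointBlowupLSB.isRegular_Z 4 K)
  -- the closed order-`p` points OFF the centre: a point configuration with re-centred root charts
  have hfin₀ := finite_closedPoints_off_of_finite_roots (p := p) F hS.2 hroots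
  set pts : Finset (P 4 K) := hfin₀.toFinset with hpts
  have hmem : ∀ x : P 4 K, x ∈ pts ↔ IsClosed ({x} : Set (P 4 K)) ∧ (p : ℕ∞) ≤ idealOrder M₀.ideal x ∧
      x ∉ AffineCoordBlowup.CΛ 4 K (insert 0 (Fin.succ '' (S : Set (Fin 4)))) := fun x => by
    rw [hpts, Set.Finite.mem_toFinset, Set.mem_setOf_eq]
  set st : P 4 K → State K := fun x =>
    if hx : IsClosed ({x} : Set (P 4 K)) then
      ⟨deletePthPowers p (PointBlowup.translate (exists_eq_vanishingIdeal_cons_of_isClosed hx).choose_spec.choose F),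
        0, ∅⟩
    else ⟨F, 0, ∅⟩ with hst
  have hdata : ∀ x ∈ pts, (st x).F ≠ 0 ∧
      Literature.Barriers.ResolutionOfSingularities.HauserPerlega.IsClean p (st x).F ∧
      (p : ℕ∞) ≤ CentreBlowup.ordAlong (Finset.univ : Finset (Fin 4)) (st x).F ∧
      Acc (fun s' s : State K => Edge p Finset.univ s s') (st x) ∧
      (∀ s' : State K, Relation.ReflTransGen (fun a b : State K => Edge p Finset.univ a b) (st x) s' →
        {w' : blowup (Scheme.IdealSheafData.vanishingIdeal (AffinePointBlowup.C₀ 4 K)) |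
          IsClosed ({w'} : Set (blowup (Scheme.IdealSheafData.vanishingIdeal (AffinePointBlowup.C₀ 4 K)))) ∧
          blowup.π (Scheme.IdealSheafData.vanishingIdeal (AffinePointBlowup.C₀ 4 K)) w' = ξ 4 K ∧
          (p : ℕ∞) ≤ idealOrder ((⟨hypSheaf p s'.F, [], p⟩ : MarkedIdeal (P 4 K)).transform
            (blowup.π (Scheme.IdealSheafData.vanishingIdeal (AffinePointBlowup.C₀ 4 K)))
            (Scheme.IdealSheafData.vanishingIdeal (AffinePointBlowup.C₀ 4 K))).ideal w'}.Finite) ∧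
      ∃ (Y : Scheme.{0}) (φ : Y ⟶ P 4 K) (ψ : Y ⟶ P 4 K) (_ : IsOpenImmersion φ) (_ : IsOpenImmersion ψ) (y : Y),
        φ y = x ∧ ψ y = ξ 4 K ∧ M₀.ideal.comap φ = (hypSheaf p (st x).F).comap ψ := by
    intro x hx
    obtain ⟨hxc, hord, hxC⟩ := (hmem x).mp hx
    set a := (exists_eq_vanishingIdeal_cons_of_isClosed hxc).choose with ha
    set b := (exists_eq_vanishingIdeal_cons_of_isClosed hxc).choose_spec.choose with hb
    have hxab : x.asIdeal = MvPolynomial.vanishingIdeal K {(Fin.cons a b : Fin (4 + 1) → K)} :=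
      (exists_eq_vanishingIdeal_cons_of_isClosed hxc).choose_spec.choose_spec
    have hstx : st x = ⟨deletePthPowers p (PointBlowup.translate b F), 0, ∅⟩ := by
      rw [hst]
      exact dif_pos hxc
    have hord' := (natCast_le_idealOrder_hypSheaf_iff (p := p) F hxab p).mp hord
    rw [natCast_le_ordZero_translate_hyp_iff] at hord'
    obtain ⟨hab, H⟩ := hord'
    have hbS : ¬ ∀ i ∈ S, b i = 0 := by
      intro hbS
      have hFb : MvPolynomial.eval b F = 0 :=
        eval_eq_zero_of_one_le_ordAlong (le_trans (by exact_mod_cast hp.out.one_lt.le) hS.2) hbS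
      have ha0 : a = 0 := by
        rw [hFb, add_zero] at hab
        exact pow_eq_zero_iff hp.out.ne_zero |>.mp hab
      exact hxC (mem_CΛ_of_cons hxab ha0 hbS)
    obtain ⟨φ, _, hφ, hMφ⟩ := exists_chart_recenter (p := p) F a b hab hxab
    obtain ⟨haccx, hlocx⟩ := hwalk₀ b H hbS
    rw [hstx]
    refine ⟨deletePthPowers_translate_ne_zero hF hclean b, isClean_deletePthPowers _,
      ordAlong_univ_deletePthPowers_translate F b H, haccx, fun s' hs' => ?_, P 4 K, φ, 𝟙 _, inferInstance,
      inferInstance, ξ 4 K, hφ, rfl, by rw [Scheme.IdealSheafData.comap_id]; exact hMφ⟩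
    exact finite_closedOver_model_of_finite_pairs s'
      (ordAlong_univ_of_reflTransGen_edge (ordAlong_univ_deletePthPowers_translate F b H) hs') (hlocx s' hs')
  -- the root INVARIANT of the coordinate side: identity chart, closed centre, empty boundary
  have hπ' : IsBlowup π (vanishingIdeal (closureImage (𝟙 (P 4 K))
      ((AffineCoordBlowup.𝓘Λ 4 K (insert 0 (Fin.succ '' (S : Set (Fin 4))))).support : Set (P 4 K)))) := by
    rw [globalCentre_id]
    exact hπ
  have hT : IsClosed (((𝟙 (P 4 K) : P 4 K ⟶ P 4 K) : P 4 K → P 4 K) ''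
      (AffineCoordBlowup.CΛ 4 K (insert 0 (Fin.succ '' (S : Set (Fin 4)))) : Set (P 4 K))) := by
    rw [image_id_eq]
    exact (AffineCoordBlowup.CΛ 4 K _).isClosed
  have hEc : HasSNCWith (M₀.boundary.map (·.comap (𝟙 (P 4 K))))
      (AffineCoordBlowup.𝓘Λ 4 K (insert 0 (Fin.succ '' (S : Set (Fin 4))))) :=
    ChartDictionary.hasSNCWith_nil_𝓘Λ _
  have hM₁ : M₀.ideal.comap (𝟙 (P 4 K)) = hypSheaf p (⟨F, 0, ∅⟩ : State K).F := Scheme.IdealSheafData.comap_id _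
  exact exists_isMarkedResolution_coord_step_then_points M₀ hE₀ rfl (IsMultipleBlowup.refl M₀) (𝟙 (P 4 K))
    ⟨F, 0, ∅⟩ hM₁ hF hclean hS hT hEc hπ' hfin hwalk pts st (fun x hx => ((hmem x).mp hx).1)
    (fun x hx hxC => ((hmem x).mp hx).2.2 (by rwa [image_id_eq] at hxC))
    (fun z hz hzo => by
      by_cases hzC : z ∈ AffineCoordBlowup.CΛ 4 K (insert 0 (Fin.succ '' (S : Set (Fin 4))))
      · exact Or.inl (by rw [image_id_eq]; exact hzC)
      · exact Or.inr ((hmem z).mpr ⟨hz, hzo, hzC⟩))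
    hdata

end Root

end Equimultiple

end Summit.ResolutionOfSingularities.ResolutionOfSingularities.Theorems.PIDim4

end
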